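import Mathlib
import Literature.Computability.AlgebraicComplexity.SmallFormatRank
import Summits.MatrixMultiplication.MatrixMultiplication.Theses.SchurWeylEquivariant

/-!
# `StrassenPowerEquivariant` — Kronecker powers of Strassen's decomposition are `S_N`-equivariant

Route `MatrixMultiplication/SchurWeylEquivariant`, item `stmt-MatrixMultiplication-3555` (support,
rank 9; calibration of the equivariance predicate): for every `N` the `N`-th Kronecker power of
Strassen's seven-term decomposition `⟨2,2,2⟩ = ∑_{k=1}^{7} w_k ⊗ u_k ⊗ v_k`
(`matMulTensor_two_eq_sum_strassen`, Strassen 1969) is a decomposition of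
`T_N = ⟨2,2,2⟩^{⊠N} = kroneckerPow (matMulTensor ℂ 2 2 2) N` into `7^N` triads which is
`S_N`-equivariant, i.e. `R^eq_N ≤ 7^N`.

Proof. Label the triads by words `f : Fin N → Fin 7` through `finFunctionFinEquiv :
(Fin N → Fin 7) ≃ Fin (7^N)`; the `f`-th triad has legs `a ↦ ∏ᵢ w_{f i} (a i)` etc., so its
entries are `∏ᵢ (w_{f i} ⊗ u_{f i} ⊗ v_{f i}) (a i) (b i) (c i)` and summing over all words gives
`∏ᵢ ⟨2,2,2⟩ (a i) (b i) (c i)` (distributivity, `Fintype.prod_sum`). A permutation `σ` of the `N`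
Kronecker positions acts on the legs by `a ↦ a ∘ σ`; this carries the `f`-th triad to the
`(f ∘ σ⁻¹)`-th one, so the label permutation `π = f ↦ f ∘ σ⁻¹` (conjugated by
`finFunctionFinEquiv`) witnesses equivariance (reindex the product over `Fin N` by `σ`).

Sources: V. Strassen, *Gaussian elimination is not optimal*, Numer. Math. 13 (1969) 354–356
[Strassen1969]; M. Bläser, *Fast Matrix Multiplication*, ToC Graduate Surveys 5 (2013), §7
(tensor product of decompositions) [Blaser2013].
-/

-- Summit = sub-problem name (`MatrixMultiplication.MatrixMultiplication`, D-0017 single-conjunct layout).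
set_option linter.dupNamespace false

namespace Summit.MatrixMultiplication.MatrixMultiplication.Theorems

open scoped BigOperators
open Literature.Computability.AlgebraicComplexity

section KroneckerPowerOfDecomposition

variable {K : Type*} [CommSemiring K] {ι κ μ : Type*} {m : ℕ}

/-- **Kronecker power of a decomposition** (Bläser 2013, §7, iterated Lemma 5.8 with explicit
witnesses): if `t = ∑_{k<m} w_k ⊗ u_k ⊗ v_k` then `t^{⊠N}` is the sum over the `m^N` words
`f : Fin N → Fin m` (encoded in `Fin (m^N)` by `finFunctionFinEquiv`) of the triads with legs
`a ↦ ∏ᵢ w_{f i} (a i)`, `b ↦ ∏ᵢ u_{f i} (b i)`, `c ↦ ∏ᵢ v_{f i} (c i)`. [cite: Blaser2013, §7] -/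
theorem kroneckerPow_eq_sum_triad_of_eq_sum {t : ι → κ → μ → K} {w : Fin m → ι → K}
    {u : Fin m → κ → K} {v : Fin m → μ → K} (h : t = ∑ k, triad (w k) (u k) (v k)) (N : ℕ) :
    kroneckerPow t N = ∑ j : Fin (m ^ N),
      triad (fun a => ∏ i, w (finFunctionFinEquiv.symm j i) (a i))
        (fun b => ∏ i, u (finFunctionFinEquiv.symm j i) (b i))
        (fun c => ∏ i, v (finFunctionFinEquiv.symm j i) (c i)) := by
  funext a b c
  rw [kroneckerPow_apply, sum_triad_apply, h]
  simp_rw [sum_triad_apply]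
  rw [Fintype.prod_sum]
  rw [← (finFunctionFinEquiv (m := m) (n := N)).sum_comp]
  refine Finset.sum_congr rfl fun f _ => ?_
  simp only [Equiv.symm_apply_apply]
  rw [Finset.prod_mul_distrib, Finset.prod_mul_distrib]

/-- **Equivariance of the Kronecker-power decomposition under `S_N`**: permuting the `N` Kronecker
positions by `σ` (legs precomposed with `σ`) carries the triad labelled by the word `f` to the
triad labelled by `f ∘ σ⁻¹`; with labels encoded in `Fin (m^N)` the label permutation is
`finFunctionFinEquiv.permCongr (σ.arrowCongr (Equiv.refl _))`. [folklore] -/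
theorem triad_prod_perm (w : Fin m → ι → K) (u : Fin m → κ → K) (v : Fin m → μ → K) (N : ℕ)
    (σ : Equiv.Perm (Fin N)) (j : Fin (m ^ N)) :
    triad
        (fun a => ∏ i, w (finFunctionFinEquiv.symm
          ((finFunctionFinEquiv.permCongr (σ.arrowCongr (Equiv.refl (Fin m)))) j) i) (a i))
        (fun b => ∏ i, u (finFunctionFinEquiv.symm
          ((finFunctionFinEquiv.permCongr (σ.arrowCongr (Equiv.refl (Fin m)))) j) i) (b i))
        (fun c => ∏ i, v (finFunctionFinEquiv.symm
          ((finFunctionFinEquiv.permCongr (σ.arrowCongr (Equiv.refl (Fin m)))) j) i) (c i)) =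
      fun (a : Fin N → ι) (b : Fin N → κ) (c : Fin N → μ) =>
        triad (fun a => ∏ i, w (finFunctionFinEquiv.symm j i) (a i))
          (fun b => ∏ i, u (finFunctionFinEquiv.symm j i) (b i))
          (fun c => ∏ i, v (finFunctionFinEquiv.symm j i) (c i)) (a ∘ σ) (b ∘ σ) (c ∘ σ) := by
  funext a b c
  simp only [triad_apply, Equiv.permCongr_apply, Equiv.symm_apply_apply, Equiv.arrowCongr_apply,
    Equiv.coe_refl, Function.comp_apply, id_eq]
  rw [← Equiv.prod_comp σ (fun i => w (finFunctionFinEquiv.symm j (σ.symm i)) (a i)),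
    ← Equiv.prod_comp σ (fun i => u (finFunctionFinEquiv.symm j (σ.symm i)) (b i)),
    ← Equiv.prod_comp σ (fun i => v (finFunctionFinEquiv.symm j (σ.symm i)) (c i))]
  simp only [Equiv.symm_apply_apply]

end KroneckerPowerOfDecomposition

/-- **`StrassenPowerEquivariant`** (item `stmt-MatrixMultiplication-3555`, exact route decl): for
every `N`, the `N`-th Kronecker power of Strassen's decomposition is an `S_N`-equivariant
decomposition of `⟨2,2,2⟩^{⊠N}` into `7^N` triads (`R^eq_N ≤ 7^N`). [cite: Strassen1969] -/
theorem strassenPowerEquivariant_proof :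
    Summit.MatrixMultiplication.MatrixMultiplication.Theses.SchurWeylEquivariant.StrassenPowerEquivariant := by
  unfold Summit.MatrixMultiplication.MatrixMultiplication.Theses.SchurWeylEquivariant.StrassenPowerEquivariant
  intro N
  refine ⟨fun j a => ∏ i, strassenW ℂ (finFunctionFinEquiv.symm j i) (a i),
    fun j b => ∏ i, strassenU ℂ (finFunctionFinEquiv.symm j i) (b i),
    fun j c => ∏ i, strassenV ℂ (finFunctionFinEquiv.symm j i) (c i),
    kroneckerPow_eq_sum_triad_of_eq_sum (matMulTensor_two_eq_sum_strassen ℂ) N, fun σ => ?_⟩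
  exact ⟨finFunctionFinEquiv.permCongr (σ.arrowCongr (Equiv.refl (Fin 7))), fun j =>
    triad_prod_perm (strassenW ℂ) (strassenU ℂ) (strassenV ℂ) N σ j⟩

end Summit.MatrixMultiplication.MatrixMultiplication.Theorems
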